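import Summits.Ventures.PercRepro.S1TriangleUnionGeneral
import Summits.Ventures.PercRepro.S1CellNineSevenFiveCaps

/-!
# PercRepro — THE TIGHT COVER BOUND AND THE TRIANGLE BOUND (T9,5) (p2, gen 27; SUBCLAIM-S1 §6.10)

A family of circuits each holding a point outside a base set `B` and outside the other members («shelling»)
raises the nullity of `B` by the size of the family (`eRk_union_circuit_add_le`, one member at a time). On a
matroid with (C1) whose `n` points all lie on triangles, a minimum cover `ℱ` by triangles is such a family over
`B = ∅`, so `|ℱ| ≤ ν`; with `n ≥ 3ν − 2` it has exactly `ν` members and at most two overlaps, and any further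
triangle `T` extends it to a shelling of `ν + 1` members (`T` first, or after the one member whose only private
point lies in `T`) — so `s₃ ≤ ν`. The bound is sharp (`M(K₄)`: `n = 6 = 3ν − 3`, `s₃ = 4`).

At nullity `5` on `13` or `14` points (the `(9, 5)` cores): the union of the triangles has nullity `4` (then
`s₃ ≤ cq3 4 = 5`) or `5` (then every point is on a triangle and `n ≥ 13 = 3·5 − 2`, so `s₃ ≤ 5`) — this is the
hypothesis (T9,5) of `c025_core_nine_seven_of_caps`' sibling `c025_core_nine_five_of_caps`, discharged.

* `le_of_eRk_add_le` — reading a nullity inequality in `ℕ`;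
* `encard_biUnion_le_three_mul` — a family of `3`-sets covers `≤ 3·|ℱ|` points;
* **`eRk_union_biUnion_add_le`** — shelling raises the nullity;
* **`ncard_triangles_le_of_cover`** — the tight cover bound `s₃ ≤ ν` at `n ≥ 3ν − 2`;
* **`ncard_triangles_le_five_of_nullity_five`** — (T9,5);
* **`c025_core_nine_five_of_caps'`** — the cell `(9, 5)` modulo its three bounded cap tables only.
Axioms: standard.
-/

open scoped Matroid

namespace PercRepro

namespace S1

open Set

variable {α : Type}

/-- From `r(S) + a ≤ |S|` and `|S| = r(S) + ν` (finite `S ⊆ E`): `a ≤ ν`. -/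
theorem le_of_eRk_add_le (M : Matroid α) [M.Finite] {S : Set α} (hS : S ⊆ M.E) {a ν : ℕ}
    (h : M.eRk S + (a : ℕ∞) ≤ S.encard) (hν : S.encard = M.eRk S + (ν : ℕ∞)) : a ≤ ν := by
  have hr : M.eRk S ≠ ⊤ := ((M.eRk_le_encard S).trans_lt (M.ground_finite.subset hS).encard_lt_top).ne
  obtain ⟨r, hr⟩ := ENat.ne_top_iff_exists.1 hr
  rw [hν, ← hr] at h
  have : r + a ≤ r + ν := by exact_mod_cast h
  omega

/-- A finite family of sets of at most `3` points covers at most `3·|ℱ|` points. -/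
theorem encard_biUnion_le_three_mul (ℱ : Finset (Set α)) (h3 : ∀ C ∈ ℱ, C.encard ≤ 3) :
    (⋃ C ∈ ℱ, C).encard ≤ ((3 * ℱ.card : ℕ) : ℕ∞) := by
  classical
  induction ℱ using Finset.induction_on with
  | empty => simp
  | insert C ℱ' hC ih =>
    rw [Finset.set_biUnion_insert, Finset.card_insert_of_notMem hC]
    have ih' := ih (fun C' h => h3 C' (Finset.mem_insert_of_mem h))
    calc (C ∪ ⋃ C' ∈ ℱ', C').encard ≤ C.encard + (⋃ C' ∈ ℱ', C').encard := Set.encard_union_le _ _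
      _ ≤ 3 + ((3 * ℱ'.card : ℕ) : ℕ∞) := add_le_add (h3 C (Finset.mem_insert_self _ _)) ih'
      _ = ((3 * (ℱ'.card + 1) : ℕ) : ℕ∞) := by push_cast; ring

/-- **Shelling raises the nullity**: for `B ⊆ E` of nullity `b` and a finite family `ℱ` of circuits, each holding a
point outside `B` and outside every other member, `ν(B ∪ ⋃ℱ) ≥ b + |ℱ|`. -/
theorem eRk_union_biUnion_add_le (M : Matroid α) [M.Finite] {B : Set α} (hB : B ⊆ M.E) {b : ℕ}
    (hνB : B.encard = M.eRk B + (b : ℕ∞)) (ℱ : Finset (Set α)) (hℱ : ∀ C ∈ ℱ, M.IsCircuit C)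
    (hpriv : ∀ C ∈ ℱ, ∃ x ∈ C, x ∉ B ∧ ∀ C' ∈ ℱ, C' ≠ C → x ∉ C') :
    M.eRk (B ∪ ⋃ C ∈ ℱ, C) + ((b + ℱ.card : ℕ) : ℕ∞) ≤ (B ∪ ⋃ C ∈ ℱ, C).encard := by
  classical
  induction ℱ using Finset.induction_on with
  | empty => simp [hνB]
  | insert C ℱ' hC ih =>
    have hℱ' : ∀ C' ∈ ℱ', M.IsCircuit C' := fun C' h => hℱ C' (Finset.mem_insert_of_mem h)
    have hpriv' : ∀ C' ∈ ℱ', ∃ x ∈ C', x ∉ B ∧ ∀ C'' ∈ ℱ', C'' ≠ C' → x ∉ C'' := by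
      intro C' h
      obtain ⟨x, hx, hxB, hx'⟩ := hpriv C' (Finset.mem_insert_of_mem h)
      exact ⟨x, hx, hxB, fun C'' h'' hne => hx' C'' (Finset.mem_insert_of_mem h'') hne⟩
    have ih' := ih hℱ' hpriv'
    have hSE : B ∪ ⋃ C' ∈ ℱ', C' ⊆ M.E :=
      union_subset hB (iUnion₂_subset fun C' h => (hℱ' C' h).subset_ground)
    obtain ⟨ν, hν⟩ := exists_nullity M hSE
    have hcard : b + ℱ'.card ≤ ν := le_of_eRk_add_le M hSE ih' hν
    have hCirc : M.IsCircuit C := hℱ C (Finset.mem_insert_self C ℱ')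
    have hCS : ¬ C ⊆ B ∪ ⋃ C' ∈ ℱ', C' := by
      obtain ⟨x, hx, hxB, hx'⟩ := hpriv C (Finset.mem_insert_self C ℱ')
      intro h
      rcases h hx with hxB' | hxU
      · exact hxB hxB'
      · rw [mem_iUnion₂] at hxU
        obtain ⟨C', hC', hxC'⟩ := hxU
        exact hx' C' (Finset.mem_insert_of_mem hC') (fun h => hC (h ▸ hC')) hxC'
    have key := eRk_union_circuit_add_le M hSE hCirc hCS hν
    have hU : B ∪ ⋃ C' ∈ insert C ℱ', C' = (B ∪ ⋃ C' ∈ ℱ', C') ∪ C := by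
      rw [Finset.set_biUnion_insert]
      ext y
      simp only [mem_union]
      tauto
    rw [hU, Finset.card_insert_of_notMem hC]
    have hfin : ((B ∪ ⋃ C' ∈ ℱ', C') ∪ C).Finite :=
      M.ground_finite.subset (union_subset hSE hCirc.subset_ground)
    rw [← hfin.cast_ncard_eq]
    calc M.eRk ((B ∪ ⋃ C' ∈ ℱ', C') ∪ C) + ((b + (ℱ'.card + 1) : ℕ) : ℕ∞)
        ≤ M.eRk ((B ∪ ⋃ C' ∈ ℱ', C') ∪ C) + ((ν + 1 : ℕ) : ℕ∞) := by
          have h1 : ((b + (ℱ'.card + 1) : ℕ) : ℕ∞) ≤ ((ν + 1 : ℕ) : ℕ∞) := by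
            exact_mod_cast (show b + (ℱ'.card + 1) ≤ ν + 1 by omega)
          exact add_le_add le_rfl h1
      _ ≤ _ := key

open Classical in
/-- **THE TIGHT COVER BOUND**: under (C1), if every point of `E` lies on a triangle and `|E| ≥ 3ν − 2`, where
`ν = |E| − r(E)`, then there are at most `ν` triangles. -/
theorem ncard_triangles_le_of_cover (M : Matroid α) [M.Finite]
    (hC1 : ∀ L ⊆ M.E, M.eRk L = 2 → L.ncard ≤ 3) {d : ℕ} (hd : M.E.encard = M.eRank + (d : ℕ∞))
    (hcov : ∀ x ∈ M.E, ∃ C, M.IsCircuit C ∧ C.ncard = 3 ∧ x ∈ C) (hn : 3 * d ≤ M.E.ncard + 2) :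
    {C : Set α | M.IsCircuit C ∧ C.ncard = 3}.ncard ≤ d := by
  by_contra hlt
  push Not at hlt
  have hmem𝒯 : ∀ C, C ∈ (finite_triangles M).toFinset ↔ M.IsCircuit C ∧ C.ncard = 3 := fun C => by
    rw [Set.Finite.mem_toFinset]; rfl
  have h𝒯card : (finite_triangles M).toFinset.card = {C : Set α | M.IsCircuit C ∧ C.ncard = 3}.ncard :=
    (Set.ncard_eq_toFinset_card _ (finite_triangles M)).symm
  set 𝒯 := (finite_triangles M).toFinset with h𝒯def
  -- the covering subfamilies and a minimum one
  set covers : Finset (Finset (Set α)) := 𝒯.powerset.filter (fun ℱ => ∀ x ∈ M.E, ∃ C ∈ ℱ, x ∈ C) with hcovdef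
  have h𝒯cov : 𝒯 ∈ covers := by
    refine Finset.mem_filter.2 ⟨Finset.mem_powerset.2 (Finset.Subset.refl _), ?_⟩
    intro x hx
    obtain ⟨C, hC, h3, hxC⟩ := hcov x hx
    exact ⟨C, (hmem𝒯 C).2 ⟨hC, h3⟩, hxC⟩
  obtain ⟨ℱ, hℱcov, hℱmin⟩ := Finset.exists_min_image covers Finset.card ⟨𝒯, h𝒯cov⟩
  have hℱ𝒯 : ℱ ⊆ 𝒯 := Finset.mem_powerset.1 (Finset.mem_filter.1 hℱcov).1
  have hℱE : ∀ x ∈ M.E, ∃ C ∈ ℱ, x ∈ C := (Finset.mem_filter.1 hℱcov).2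
  have hℱtri : ∀ C ∈ ℱ, M.IsCircuit C ∧ C.ncard = 3 := fun C h => (hmem𝒯 C).1 (hℱ𝒯 h)
  -- every member of a minimum cover has a private point
  have hpriv : ∀ C ∈ ℱ, ∃ x ∈ C, ∀ C' ∈ ℱ, C' ≠ C → x ∉ C' := by
    intro C hC
    by_contra h
    push Not at h
    have hcov' : ℱ.erase C ∈ covers := by
      refine Finset.mem_filter.2 ⟨Finset.mem_powerset.2 ((Finset.erase_subset C ℱ).trans hℱ𝒯), ?_⟩
      intro x hx
      obtain ⟨C', hC', hxC'⟩ := hℱE x hx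
      by_cases hCC : C' = C
      · subst hCC
        obtain ⟨C'', hC'', hne, hxC''⟩ := h x hxC'
        exact ⟨C'', Finset.mem_erase.2 ⟨hne, hC''⟩, hxC''⟩
      · exact ⟨C', Finset.mem_erase.2 ⟨hCC, hC'⟩, hxC'⟩
    have h1 := hℱmin _ hcov'
    rw [Finset.card_erase_of_mem hC] at h1
    have hpos : 0 < ℱ.card := Finset.card_pos.2 ⟨C, hC⟩
    omega
  -- the cover is all of `E`
  have hUE : (⋃ C ∈ ℱ, C) = M.E := by
    apply Subset.antisymm
    · exact iUnion₂_subset fun C hC => (hℱtri C hC).1.subset_ground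
    · intro x hx
      obtain ⟨C, hC, hxC⟩ := hℱE x hx
      exact mem_iUnion₂.2 ⟨C, hC, hxC⟩
  have hEν : M.E.encard = M.eRk M.E + (d : ℕ∞) := by rw [M.eRk_ground]; exact hd
  -- `|ℱ| ≤ d`
  have hcard_le : ℱ.card ≤ d := by
    have h := eRk_union_biUnion_add_le M (B := ∅) (empty_subset _) (b := 0) (by simp) ℱ
      (fun C hC => (hℱtri C hC).1) (by
        intro C hC
        obtain ⟨x, hx, hx'⟩ := hpriv C hC
        exact ⟨x, hx, notMem_empty x, hx'⟩)
    rw [empty_union, hUE] at h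
    have := le_of_eRk_add_le M (Subset.refl _) h hEν
    omega
  -- `|E| ≤ 3|ℱ|`
  have hEle : M.E.ncard ≤ 3 * ℱ.card := by
    have h := encard_biUnion_le_three_mul ℱ (fun C hC => by
      rw [← (M.ground_finite.subset (hℱtri C hC).1.subset_ground).cast_ncard_eq, (hℱtri C hC).2]
      norm_num)
    rw [hUE, ← M.ground_finite.cast_ncard_eq] at h
    exact_mod_cast h
  have hℱd : ℱ.card = d := by omega
  -- a triangle outside the cover
  obtain ⟨T, hT𝒯, hTℱ⟩ : ∃ T ∈ 𝒯, T ∉ ℱ := by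
    by_contra h
    push Not at h
    have h1 : 𝒯 ⊆ ℱ := fun C hC => h C hC
    have h2 := Finset.card_le_card h1
    omega
  have hTtri := (hmem𝒯 T).1 hT𝒯
  have hTE : T ⊆ M.E := hTtri.1.subset_ground
  have hinterT : ∀ C ∈ ℱ, (T ∩ C).ncard ≤ 1 := fun C hC =>
    ncard_inter_le_one_of_triangles M hC1 hTtri (hℱtri C hC) (fun h => hTℱ (h ▸ hC))
  have hfinR : M.eRank ≠ ⊤ := by
    rw [← M.eRk_ground]
    exact ((M.eRk_le_encard _).trans_lt M.ground_finite.encard_lt_top).ne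
  by_cases hcase : ∀ C ∈ ℱ, ∃ x ∈ C, x ∉ T ∧ ∀ C' ∈ ℱ, C' ≠ C → x ∉ C'
  · -- `T` first, then the cover: a shelling of `d + 1` triangles
    have hνT : T.encard = M.eRk T + ((1 : ℕ) : ℕ∞) := by
      rw [← hTtri.1.eRk_add_one_eq]; rfl
    have h := eRk_union_biUnion_add_le M hTE hνT ℱ (fun C hC => (hℱtri C hC).1) hcase
    have hTU : T ∪ ⋃ C ∈ ℱ, C = M.E := by rw [hUE]; exact union_eq_right.2 hTE
    rw [hTU] at h
    have := le_of_eRk_add_le M (Subset.refl _) h hEν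
    omega
  · push Not at hcase
    obtain ⟨C₀, hC₀, hC₀T⟩ := hcase
    have hC₀tri := hℱtri C₀ hC₀
    have hC₀E : C₀ ⊆ M.E := hC₀tri.1.subset_ground
    have hd2 : 2 ≤ d := by
      -- `ℱ` has a member other than `C₀`: otherwise `E = C₀` has `3` points and `d ≤ 1`
      by_contra h
      push Not at h
      have hℱ1 : ℱ.card ≤ 1 := by omega
      have hsingle : ℱ = {C₀} := by
        apply Finset.eq_singleton_iff_unique_mem.2 ⟨hC₀, ?_⟩
        intro C hC
        by_contra hne
        have := Finset.one_lt_card.2 ⟨C, hC, C₀, hC₀, hne⟩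
        omega
      rw [hsingle] at hUE
      simp only [Finset.mem_singleton, iUnion_iUnion_eq_left] at hUE
      have h3 : M.E.ncard = 3 := by rw [← hUE]; exact hC₀tri.2
      -- `T ⊆ E = C₀` with `3` points forces `T = C₀`
      have hTC : T = C₀ :=
        Set.eq_of_subset_of_ncard_le (hUE ▸ hTE) (by rw [hC₀tri.2, hTtri.2]) (M.ground_finite.subset hC₀E)
      exact hTℱ (hTC ▸ hC₀)
    -- every other member has a private point outside `C₀ ∪ T`
    have hothers : ∀ C ∈ ℱ.erase C₀, ∃ x ∈ C, x ∉ C₀ ∪ T ∧ ∀ C' ∈ ℱ.erase C₀, C' ≠ C → x ∉ C' := by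
      intro C hC
      have hCℱ := Finset.mem_of_mem_erase hC
      have hCne : C ≠ C₀ := Finset.ne_of_mem_erase hC
      by_contra h
      push Not at h
      -- then `E ⊆ (C₀ ∩ T) ∪ (C ∩ T) ∪ (C ∩ C₀) ∪ ⋃ (ℱ ∖ {C₀, C})`
      set 𝒢 := (ℱ.erase C₀).erase C with h𝒢def
      have hcover : M.E ⊆ ((T ∩ C₀) ∪ (T ∩ C) ∪ (C ∩ C₀)) ∪ ⋃ C' ∈ 𝒢, C' := by
        intro y hy
        obtain ⟨C'', hC'', hyC''⟩ := hℱE y hy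
        by_cases h0 : C'' = C₀
        · subst h0
          by_cases hyT : y ∈ T
          · exact Or.inl (Or.inl (Or.inl ⟨hyT, hyC''⟩))
          · obtain ⟨C', hC', hne, hyC'⟩ := hC₀T y hyC'' hyT
            by_cases hC'C : C' = C
            · subst hC'C
              exact Or.inl (Or.inr ⟨hyC', hyC''⟩)
            · exact Or.inr (mem_iUnion₂.2 ⟨C', Finset.mem_erase.2 ⟨hC'C, Finset.mem_erase.2 ⟨hne, hC'⟩⟩, hyC'⟩)
        by_cases h1 : C'' = C
        · subst h1
          by_cases hyB : y ∈ C₀ ∪ T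
          · rcases hyB with hyC₀ | hyT
            · exact Or.inl (Or.inr ⟨hyC'', hyC₀⟩)
            · exact Or.inl (Or.inl (Or.inr ⟨hyT, hyC''⟩))
          · obtain ⟨C', hC', hne, hyC'⟩ := h y hyC'' hyB
            exact Or.inr (mem_iUnion₂.2 ⟨C', Finset.mem_erase.2 ⟨hne, hC'⟩, hyC'⟩)
        exact Or.inr (mem_iUnion₂.2 ⟨C'', Finset.mem_erase.2 ⟨h1, Finset.mem_erase.2 ⟨h0, hC''⟩⟩, hyC''⟩)
      have h𝒢card : 𝒢.card = d - 2 := by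
        rw [h𝒢def, Finset.card_erase_of_mem hC, Finset.card_erase_of_mem hC₀, hℱd]
        omega
      have hbig : (⋃ C' ∈ 𝒢, C').encard ≤ ((3 * (d - 2) : ℕ) : ℕ∞) := by
        rw [← h𝒢card]
        exact encard_biUnion_le_three_mul 𝒢 (fun C' hC' => by
          have h' := hℱtri C' (Finset.mem_of_mem_erase (Finset.mem_of_mem_erase hC'))
          rw [← (M.ground_finite.subset h'.1.subset_ground).cast_ncard_eq, h'.2]
          norm_num)
      have hsmall : ∀ X : Set α, X ⊆ M.E → X.ncard ≤ 1 → X.encard ≤ 1 := fun X hX h => by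
        rw [← (M.ground_finite.subset hX).cast_ncard_eq]; exact_mod_cast h
      have hTC₀ : (T ∩ C₀).encard ≤ 1 := hsmall _ (inter_subset_left.trans hTE) (hinterT C₀ hC₀)
      have hTC : (T ∩ C).encard ≤ 1 := hsmall _ (inter_subset_left.trans hTE) (hinterT C hCℱ)
      have hCC₀ : (C ∩ C₀).encard ≤ 1 := hsmall _ (inter_subset_right.trans hC₀E)
        (ncard_inter_le_one_of_triangles M hC1 (hℱtri C hCℱ) hC₀tri hCne)
      have hE : M.E.encard ≤ ((3 + 3 * (d - 2) : ℕ) : ℕ∞) := by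
        calc M.E.encard ≤ (((T ∩ C₀) ∪ (T ∩ C) ∪ (C ∩ C₀)) ∪ ⋃ C' ∈ 𝒢, C').encard := encard_le_encard hcover
          _ ≤ ((T ∩ C₀) ∪ (T ∩ C) ∪ (C ∩ C₀)).encard + (⋃ C' ∈ 𝒢, C').encard := Set.encard_union_le _ _
          _ ≤ ((T ∩ C₀).encard + (T ∩ C).encard + (C ∩ C₀).encard) + (⋃ C' ∈ 𝒢, C').encard :=
              add_le_add ((Set.encard_union_le _ _).trans (add_le_add (Set.encard_union_le _ _) le_rfl)) le_rfl
          _ ≤ (1 + 1 + 1) + ((3 * (d - 2) : ℕ) : ℕ∞) := add_le_add (add_le_add (add_le_add hTC₀ hTC) hCC₀) hbig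
          _ = ((3 + 3 * (d - 2) : ℕ) : ℕ∞) := by push_cast; ring
      rw [← M.ground_finite.cast_ncard_eq] at hE
      have hE' : M.E.ncard ≤ 3 + 3 * (d - 2) := by exact_mod_cast hE
      omega
    -- the base `C₀ ∪ T` has nullity `≥ 2`
    have hνC₀ : C₀.encard = M.eRk C₀ + ((1 : ℕ) : ℕ∞) := by
      rw [← hC₀tri.1.eRk_add_one_eq]; rfl
    have hTC₀ : ¬ T ⊆ C₀ := by
      intro h
      have hTC : T = C₀ :=
        Set.eq_of_subset_of_ncard_le h (by rw [hC₀tri.2, hTtri.2]) (M.ground_finite.subset hC₀E)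
      exact hTℱ (hTC ▸ hC₀)
    have hkey := eRk_union_circuit_add_le M hC₀E hTtri.1 hTC₀ hνC₀
    have hBE : C₀ ∪ T ⊆ M.E := union_subset hC₀E hTE
    obtain ⟨b, hb⟩ := exists_nullity M hBE
    have hb2 : 2 ≤ b := by
      rw [(M.ground_finite.subset hBE).cast_ncard_eq] at hkey
      exact le_of_eRk_add_le M hBE hkey hb
    have h := eRk_union_biUnion_add_le M hBE hb (ℱ.erase C₀)
      (fun C hC => (hℱtri C (Finset.mem_of_mem_erase hC)).1) hothers
    have hBU : (C₀ ∪ T) ∪ ⋃ C ∈ ℱ.erase C₀, C = M.E := by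
      apply Subset.antisymm
      · exact union_subset hBE (iUnion₂_subset fun C hC => (hℱtri C (Finset.mem_of_mem_erase hC)).1.subset_ground)
      · intro y hy
        rw [← hUE] at hy
        rw [mem_iUnion₂] at hy
        obtain ⟨C, hC, hyC⟩ := hy
        by_cases h0 : C = C₀
        · subst h0; exact Or.inl (Or.inl hyC)
        · exact Or.inr (mem_iUnion₂.2 ⟨C, Finset.mem_erase.2 ⟨h0, hC⟩, hyC⟩)
    rw [hBU, Finset.card_erase_of_mem hC₀, hℱd] at h
    have := le_of_eRk_add_le M (Subset.refl _) h hEν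
    omega

/-- **(T9,5)**: a coloop-free `e`-free matroid of nullity `5` with `13` or `14` points has at most `5` triangles —
the union of the triangles has nullity `4` (then `s₃ ≤ cq3 4 = 5`) or `5` (then it is `E`, every point on a
triangle, and `|E| ≥ 13 = 3·5 − 2`: the tight cover bound). -/
theorem ncard_triangles_le_five_of_nullity_five (N : Matroid α) [N.Finite]
    (hfree : ∀ e ∈ N.E, ∃ A ⊆ N.E \ {e}, e ∉ N.closure A ∧ e ∉ N.closure ((N.E \ {e}) \ A))
    (hd : N.E.encard = N.eRank + ((5 : ℕ) : ℕ∞)) (h13 : 13 ≤ N.E.ncard) (hcol : N.coloops = ∅) :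
    {C : Set α | N.IsCircuit C ∧ C.ncard = 3}.ncard ≤ 5 := by
  by_contra hlt
  push Not at hlt
  have hL : ∀ e ∈ N.E, ¬ N.IsLoop e := ThmN.not_isLoop_of_free N hfree
  have hC1 : ∀ L ⊆ N.E, N.eRk L = 2 → L.ncard ≤ 3 := by
    intro L hL' hr
    have := ThmN.ncard_add_one_le_two_pow_of_eRk_le N hL hfree 2 L hL' hr.le
    omega
  have hcq : TriangleCap.cq3 (5 - 2) < {C : Set α | N.IsCircuit C ∧ C.ncard = 3}.ncard := by
    have : TriangleCap.cq3 (5 - 2) = 4 := by decide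
    omega
  obtain ⟨S, hSE, hcov, hsub, ν, hν, hν4, hν5, hSeq, -⟩ := exists_triangle_union_of_cq3_lt N hfree hd hcol hcq
  have hStri : {C : Set α | N.IsCircuit C ∧ C.ncard = 3 ∧ C ⊆ S} = {C : Set α | N.IsCircuit C ∧ C.ncard = 3} :=
    Set.ext fun C => ⟨fun h => ⟨h.1, h.2.1⟩, fun h => ⟨h.1, h.2, hsub C h.1 h.2⟩⟩
  rcases (show ν = 4 ∨ ν = 5 by omega) with h4 | h5
  · have h := ncard_triangles_subset_le_cq3 N hfree hSE hν
    rw [hStri, h4] at h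
    have : TriangleCap.cq3 4 = 5 := by decide
    omega
  · have hS := hSeq h5
    subst hS
    have h := ncard_triangles_le_of_cover N hC1 hd (fun x hx => by
      obtain ⟨C, hC, h3, -, hxC⟩ := hcov x hx
      exact ⟨C, hC, h3, hxC⟩) (by omega)
    omega

/-- **THE CELL `(9, 5)` MODULO ITS THREE BOUNDED CAP TABLES** — the triangle bound (T9,5) discharged. -/
theorem c025_core_nine_five_of_caps' (M : Matroid α) [M.Finite] (hR : M.eRank = (9 : ℕ)) (hn : M.E.ncard = 14)
    (hfree : ∀ e ∈ M.E, ∃ A ⊆ M.E \ {e}, e ∉ M.closure A ∧ e ∉ M.closure ((M.E \ {e}) \ A))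
    (hcap14 : ∀ (N : Matroid α) [N.Finite],
      (∀ e ∈ N.E, ∃ A ⊆ N.E \ {e}, e ∉ N.closure A ∧ e ∉ N.closure ((N.E \ {e}) \ A)) →
      N.E.encard = N.eRank + ((5 : ℕ) : ℕ∞) → N.E.ncard = 14 → N.coloops = ∅ →
      ∀ t, 1 ≤ t → t ≤ 5 → {C : Set α | N.IsCircuit C ∧ C.ncard = 3}.ncard = t →
      {C : Set α | N.IsCircuit C ∧ C.ncard = 4}.ncard ≤ capNineFive14 t)
    (hcap13 : ∀ (N : Matroid α) [N.Finite],
      (∀ e ∈ N.E, ∃ A ⊆ N.E \ {e}, e ∉ N.closure A ∧ e ∉ N.closure ((N.E \ {e}) \ A)) →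
      N.E.encard = N.eRank + ((5 : ℕ) : ℕ∞) → N.E.ncard = 13 → N.coloops = ∅ →
      ∀ t, t ≤ 5 → {C : Set α | N.IsCircuit C ∧ C.ncard = 3}.ncard = t →
      {C : Set α | N.IsCircuit C ∧ C.ncard = 4}.ncard ≤ capNineFive13 t)
    (hcap12 : ∀ (N : Matroid α) [N.Finite],
      (∀ e ∈ N.E, ∃ A ⊆ N.E \ {e}, e ∉ N.closure A ∧ e ∉ N.closure ((N.E \ {e}) \ A)) →
      N.E.encard = N.eRank + ((5 : ℕ) : ℕ∞) → N.E.ncard = 12 → N.coloops = ∅ →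
      ∀ t, 1 ≤ t → t ≤ 6 → {C : Set α | N.IsCircuit C ∧ C.ncard = 3}.ncard = t →
      {C : Set α | N.IsCircuit C ∧ C.ncard = 4}.ncard ≤ capNineFive12 t) :
    ThmN.RLS M 9 4 :=
  c025_core_nine_five_of_caps M hR hn hfree
    (fun N _ hNfree hNd h13 _ hNcol => ncard_triangles_le_five_of_nullity_five N hNfree hNd h13 hNcol)
    hcap14 hcap13 hcap12

end S1

end PercRepro
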